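import Summits.Ventures.PercRepro.C026Pendant

/-!
# C-026 (class form) on every forest (mine-3 dossier §13, Theorem 13.1) — part A: `(CF)`, leaves, Lemma P_a (p5, gen 7)

The class lemma `(CF)_G(a, b, c)`: `#{S : a ~_S b, c ≁_{S̄} a, c ≁_{S̄} b} ≤ #{S : one pair of (a, b, c) joined in S}`.
Three reductions strip a pendant vertex: **Lemma P_a** (`cf_of_leaf_a`: if `a` is a leaf — a single edge `f = aw` —
`(CF)` holds outright: a configuration of the left side has `f` open; closing `f` when `b ~ c`, and keeping it when
`b ≁ c`, injects the left side into the right side), **Lemma P_c** (`pendant_reduction`: `c` pendant at `w` — `(CF)`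
for `(a, b, c)` is `(CF)` for `(a, b, w)` on the star-closed configurations) and **Lemma P_v** (`scaling_reduction`:
a pendant non-mark — both sides scale).  The star-closed configurations of `G` are the configurations of the
multigraph `G − v` (`minus`, the same vertices, the edges away from `v`; `conn_minus_iff`, `cf_minus_iff`), and a
forest (`IsForest`: every vertex-deleted sub-multigraph with an edge has a leaf) stays a forest under `minus`; so
induction on the number of edges gives **`cf_forest`**: `(CF)` on every forest, for every three distinct marks.

Part A (split for the ≤ 400-line lint): the class lemma `CF` and its symmetries, leaves (`IsLeaf`) and Lemma P_a
(`cf_of_leaf_a`); the last part `C026Forest.lean` imports it.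
-/

namespace PercRepro

open Finset

namespace MultiGraph

variable {V E : Type*} (G : MultiGraph V E)

/-! ### The class lemma and its symmetry -/

open Classical in
/-- **The class lemma `(CF)` of C-026** for the marks `(a, b, c)` (mine-3 §11, the inequality of
`pendant_reduction` / `scaling_reduction`): `#{a ~_S b ∧ c iso in S̄} ≤ #OnePair_S(a, b, c)`. -/
def CF [Fintype E] [DecidableEq E] (a b c : V) : Prop :=
  (Finset.univ.filter fun S : Config E => G.Conn S a b ∧ G.IsCIso Sᶜ a b c).card ≤
    (Finset.univ.filter fun S : Config E => G.OnePair S a b c).card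

/-- `OnePair` is «exactly one of the three pairs is joined». -/
theorem onePair_iff (ω : Config E) (a b c : V) :
    G.OnePair ω a b c ↔
      (G.Conn ω a b ∧ ¬ G.Conn ω a c ∧ ¬ G.Conn ω b c) ∨
        (G.Conn ω a c ∧ ¬ G.Conn ω a b ∧ ¬ G.Conn ω b c) ∨
        (G.Conn ω b c ∧ ¬ G.Conn ω a b ∧ ¬ G.Conn ω a c) := by
  unfold OnePair
  constructor
  · rintro (⟨h1, h2⟩ | ⟨h1, h2⟩ | ⟨h1, h2⟩)
    · exact Or.inl ⟨h1, h2, fun h => h2 (h1.trans h)⟩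
    · exact Or.inr (Or.inl ⟨h1, h2, fun h => h2 (h1.trans h.symm)⟩)
    · exact Or.inr (Or.inr ⟨h1, h2, fun h => h2 (h.trans h1.symm)⟩)
  · rintro (⟨h1, h2, -⟩ | ⟨h1, h2, -⟩ | ⟨h1, h2, -⟩)
    · exact Or.inl ⟨h1, h2⟩
    · exact Or.inr (Or.inl ⟨h1, h2⟩)
    · exact Or.inr (Or.inr ⟨h1, h2⟩)

/-- `OnePair` is symmetric in the first two marks. -/
theorem onePair_swap (ω : Config E) (a b c : V) : G.OnePair ω a b c ↔ G.OnePair ω b a c := by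
  rw [G.onePair_iff, G.onePair_iff, G.conn_comm (u := a) (v := b)]
  tauto

open Classical in
/-- `(CF)` is symmetric in the first two marks. -/
theorem cf_swap [Fintype E] [DecidableEq E] (a b c : V) : G.CF a b c ↔ G.CF b a c := by
  unfold CF
  have h1 : (Finset.univ.filter fun S : Config E => G.Conn S a b ∧ G.IsCIso Sᶜ a b c) =
      Finset.univ.filter fun S : Config E => G.Conn S b a ∧ G.IsCIso Sᶜ b a c := by
    apply Finset.filter_congr
    intro S _
    unfold IsCIso
    rw [G.conn_comm (u := a) (v := b)]
    tauto
  have h2 : (Finset.univ.filter fun S : Config E => G.OnePair S a b c) =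
      Finset.univ.filter fun S : Config E => G.OnePair S b a c := by
    apply Finset.filter_congr
    intro S _
    exact G.onePair_swap S a b c
  rw [h1, h2]

open Classical in
/-- `(CF)` with `c = a` is empty on the left (`c` is never isolated from itself). -/
theorem cf_of_eq_left [Fintype E] [DecidableEq E] (a b : V) : G.CF a b a := by
  unfold CF
  have : (Finset.univ.filter fun S : Config E => G.Conn S a b ∧ G.IsCIso Sᶜ a b a) = ∅ := by
    apply Finset.filter_eq_empty_iff.2
    intro S _ h
    exact h.2.1 (MultiGraph.Conn.refl G _ _)
  rw [this, Finset.card_empty]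
  exact Nat.zero_le _

open Classical in
/-- `(CF)` with `c = b` is empty on the left. -/
theorem cf_of_eq_right [Fintype E] [DecidableEq E] (a b : V) : G.CF a b b := by
  unfold CF
  have : (Finset.univ.filter fun S : Config E => G.Conn S a b ∧ G.IsCIso Sᶜ a b b) = ∅ := by
    apply Finset.filter_eq_empty_iff.2
    intro S _ h
    exact h.2.2 (MultiGraph.Conn.refl G _ _)
  rw [this, Finset.card_empty]
  exact Nat.zero_le _

/-! ### Leaves -/

/-- **A leaf**: `v ≠ w` and exactly one edge at `v`, the edge `f` joining `v` and `w`. -/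
def IsLeaf (v w : V) : Prop :=
  v ≠ w ∧ ∃ f, ((G.fst f = v ∧ G.snd f = w) ∨ (G.fst f = w ∧ G.snd f = v)) ∧
    ∀ e, (G.fst e = v ∨ G.snd e = v) → e = f

/-- A leaf is pendant. -/
theorem IsLeaf.pendant {v w : V} (h : G.IsLeaf v w) : G.Pendant v w := by
  obtain ⟨-, f, hf, huniq⟩ := h
  refine ⟨fun e he => ?_, ⟨f, ?_⟩⟩
  · have he' : G.fst e = v ∨ G.snd e = v := by
      simpa [edgesAt] using he
    rw [huniq e he']
    exact hf
  · show G.fst f ∈ ({v} : Set V) ∨ G.snd f ∈ ({v} : Set V)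
    rcases hf with ⟨h1, -⟩ | ⟨-, h2⟩
    · exact Or.inl (by rw [h1]; rfl)
    · exact Or.inr (by rw [h2]; rfl)

/-- The edges at a leaf are its single edge. -/
theorem IsLeaf.mem_star_iff {v w : V} (h : G.IsLeaf v w) {f : E}
    (hf : (G.fst f = v ∧ G.snd f = w) ∨ (G.fst f = w ∧ G.snd f = v)) (e : E) :
    e ∈ G.edgesAt ({v} : Set V) ↔ e = f := by
  obtain ⟨-, f', hf', huniq⟩ := h
  constructor
  · intro he
    have he' : G.fst e = v ∨ G.snd e = v := by simpa [edgesAt] using he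
    have hff' : f = f' := huniq f (by rcases hf with ⟨h1, -⟩ | ⟨-, h2⟩ <;> [exact Or.inl h1; exact Or.inr h2])
    rw [huniq e he', hff']
  · rintro rfl
    show G.fst e ∈ ({v} : Set V) ∨ G.snd e ∈ ({v} : Set V)
    rcases hf with ⟨h1, -⟩ | ⟨-, h2⟩
    · exact Or.inl (by rw [h1]; rfl)
    · exact Or.inr (by rw [h2]; rfl)

/-! ### Lemma P_a: a leaf mark `a` makes `(CF)` trivial -/

open Classical in
/-- **Lemma P_a** (mine-3 §13): if `a` is a leaf (its single edge `f` joins `a` and `w`), `(CF)_G(a, b, c)` holds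
outright.  A configuration `S` of the left side has `f` open (`a ~ b`, `a ≠ b`); send it to itself when `b ≁_S c`
(exactly the pair `ab` is joined) and to `S − f` when `b ~_S c` (then `a` is isolated and exactly the pair `bc` is
joined); the two kinds of images are told apart by `f`. -/
theorem cf_of_leaf_a [Fintype E] [DecidableEq E] {a w : V} (hl : G.IsLeaf a w) {b c : V} (hab : a ≠ b)
    (hac : a ≠ c) : G.CF a b c := by
  have hp : G.Pendant a w := hl.pendant
  have haw : a ≠ w := hl.1
  obtain ⟨f, hf, -⟩ := hl.2
  have hstar : ∀ e, e ∈ G.edgesAt ({a} : Set V) ↔ e = f := MultiGraph.IsLeaf.mem_star_iff G hl hf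
  -- a configuration of the left side has `f` open
  have hopen : ∀ S : Config E, G.Conn S a b → S f = true := by
    intro S h
    by_contra hS
    have hcl : G.StarClosed a S := fun e he => by
      rw [(hstar e).1 he]
      cases hSf : S f
      · rfl
      · exact absurd hSf hS
    exact hab (G.eq_c_of_conn_of_starClosed hcl h).symm
  -- closing `f` closes the star
  have hclose : ∀ S : Config E, G.StarClosed a (Function.update S f false) := by
    intro S e he
    rw [(hstar e).1 he, Function.update_self]
  have hupd : ∀ S : Config E, Function.update S f false = G.closeStar a S := by
    intro S
    funext e
    by_cases he : e ∈ G.edgesAt ({a} : Set V)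
    · rw [G.closeStar_apply_of_mem he, (hstar e).1 he, Function.update_self]
    · rw [G.closeStar_apply_of_notMem he, Function.update_of_ne (fun h => he ((hstar e).2 h))]
  unfold CF
  refine Finset.card_le_card_of_injOn
    (fun S => if G.Conn S b c then Function.update S f false else S) ?_ ?_
  · intro S hS
    rw [Finset.coe_filter] at hS
    simp only [Finset.mem_univ, true_and, Set.mem_setOf_eq] at hS
    obtain ⟨hSab, -⟩ := hS
    rw [Finset.coe_filter]
    simp only [Finset.mem_univ, true_and, Set.mem_setOf_eq]
    by_cases hbc : G.Conn S b c
    · rw [if_pos hbc]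
      have hcl := hclose S
      have hbc' : G.Conn (Function.update S f false) b c := by
        rw [hupd]
        exact (G.conn_closeStar_iff hp haw (Ne.symm hab) (Ne.symm hac)).1 hbc
      exact Or.inr (Or.inr ⟨hbc', fun h => hab (G.eq_c_of_conn_of_starClosed hcl h).symm⟩)
    · rw [if_neg hbc]
      exact Or.inl ⟨hSab, fun h => hbc (hSab.symm.trans h)⟩
  · intro S hS S' hS' h
    simp only at h
    rw [Finset.coe_filter] at hS hS'
    simp only [Finset.mem_univ, true_and, Set.mem_setOf_eq] at hS hS'
    have h1 := hopen S hS.1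
    have h2 := hopen S' hS'.1
    by_cases hbc : G.Conn S b c <;> by_cases hbc' : G.Conn S' b c
    · rw [if_pos hbc, if_pos hbc'] at h
      funext e
      by_cases he : e = f
      · rw [he, h1, h2]
      · have := congrFun h e
        rwa [Function.update_of_ne he, Function.update_of_ne he] at this
    · rw [if_pos hbc, if_neg hbc'] at h
      have := congrFun h f
      rw [Function.update_self, h2] at this
      exact absurd this (by decide)
    · rw [if_neg hbc, if_pos hbc'] at h
      have := congrFun h f
      rw [Function.update_self, h1] at this
      exact absurd this (by decide)
    · rw [if_neg hbc, if_neg hbc'] at h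
      exact h

end MultiGraph

end PercRepro
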